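/-
Copyright (c) 2026 the pub-hodgecm-mathlib formalisation cell (harness21).  Prover seat hodgecm-mathlib-K2E4-p14 (g6), Track B ∕ K2-LIT, h413 =
`stmt-HodgeConjecture-24833`, line `K2_E1_TraceFormulaBeta`, campaign «EIS-RANK-ONE» rung R6k «SPHERICAL BRACKETS»; DEAL of the dealer K2E1-plan (g4) 2026-09-04T07:00:13Z
(REPORT-FIRST census∕heads on the K2 bus 07:0xZ).
-/
import Summits.HodgeConjecture.HodgeConjecture.Theorems.K2E1MaassSelbergCMThreeFinal   -- ★ p858111 (this seat): «CM-FINAL» ED. 2 `maassSelberg_flatSectionU_cm_three_final'` (survivors `hdec′` + `hΞᵢ`)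
import HarnessLib

/-!
# K2·E1 — `K2E1MaassSelbergSphericalBracketsCMThree`: THE MAASS–SELBERG RELATION AT THE SPHERICAL (CONSTANT-COEFFICIENT) SECTIONS — ALL FOUR `K_U`-AVERAGE DATA `hΞᵢ` DISCHARGED
# (campaign «EIS-RANK-ONE», rung R6k «SPHERICAL BRACKETS», dealer K2E1-plan (g4) 2026-09-04T07:00:13Z: the `hrel`∕`hRz` feed of the pole-control capstone at the spherical vector)

Track B ∕ K2-LIT, crux h413 = `stmt-HodgeConjecture-24833`, route of record `HCCMUnconditional`; cell `hodgecm-mathlib`, squad K2, ENGINE E1.  Prover seat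
`hodgecm-mathlib-K2E4-p14` (g6).  THEOREMS ONLY (no `def`, no `instance`, no notation, no named-fact hypothesis, no `sorry`); lane `--supports stmt-HodgeConjecture-24833 --as helper`
(count-neutral).  Closes no socket.

THE MATHEMATICS [MoeglinWaldspurger1995, II.1.6–II.1.7, IV.2.3; Garrett2018, §2.8, §11.3; GindikinKarpelevich].  At CONSTANT coefficients `φ ≡ φ₀`, `φ′ ≡ φ₀′` (the spherical vectors
`f_z = φ₀·H^z`, `f′_{z′} = φ₀′·H^{z′}`) the intertwined coefficients of ★ ED. 5 are constant too: `φ̃ ≡ c(z)·φ₀` with the COMPLEX-EXPONENT standard intertwining integral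
  **`c(w) := ∫_{N(𝔸)} H(w₀ v)^w dν(v) ∈ ℂ`,   `∫_{N(𝔸)} H(w₀ v g)^w dν(v) = c(w)·H(g)^{2−w}`**   (§1, every `g`, every `w : ℂ`, no convergence hypothesis: the ℂ-twin of ★ [D8] §2–§3
— torus scaling ★ `map_torusConj_eq_torusRootModulus_smul`, Iwasawa `hBK`, Levi ★ `torusPart`, `N(𝔸)` unimodular ★, `δ_B(t) = ‖d₀‖²`, `H(t n) = ‖d₀‖`), since `(∫ φ₀′H(w₀vg)^{z′})·H(g)^{z′−2} =
φ₀′·c(z′)·H(g)^{(2−z′)+(z′−2)} = c(z′)·φ₀′` (§2 `intertwinedCoeff_const`).  Hence the four `K_U`-averages of ★ ED. 6∕«CM-FINAL» are the CONSTANT idele-class functions (§3, `m := μ_K(K_U)`,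
`K_U` compact ★ so `μ_K` finite): `Ξ₁ ≡ m·φ₀·conj φ₀′`, `Ξ₂ ≡ m·φ₀·conj(c(z′)φ₀′)`, `Ξ₃ ≡ m·c(z)φ₀·conj φ₀′`, `Ξ₄ ≡ m·c(z)φ₀·conj(c(z′)φ₀′)` — Borel, bounded, `E^×`- and `ℝ_{>0}`-invariant
trivially — and the idele-class brackets are EXPLICIT: `[Ξᵢ] = κ·Ξᵢ`, **`κ := ∫_{𝓕_I ∩ {‖x‖ ≤ 1}} ‖x‖ dν_I`**.  §4 **`maassSelberg_flatSectionU_cm_three_final_const`** = ★ «CM-FINAL» ED. 2 at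
`φ ≡ φ₀, φ′ ≡ φ₀′` with ALL `hΞᵢ` GONE and the brackets explicit ⟹ survivor `hdec′` ONLY (the decay of `E(f′) − E(f′)_B` on `{H > T}`, the [D2] chain).
HONEST LABEL: HC_CM is proved only modulo the 7 printed citations (2 remaining named inputs: hLiu418 = `stmt-HodgeConjecture-24832`, h413 = `stmt-HodgeConjecture-24833`) until rung 0
closes; this file asserts no named fact and closes no socket.
References: [MoeglinWaldspurger1995] II.1.6–II.1.7, IV.2.3 · [Garrett2018] §2.2, §2.8, §11.3 · [Rogawski1990] §1.10, §2.2 · [Arthur1980TraceFormulaII] §4.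
-/

set_option autoImplicit false
-- the mandated namespace repeats the single-problem summit's segment (`HodgeConjecture.HodgeConjecture`)
set_option linter.dupNamespace false

noncomputable section

open MeasureTheory Measure NumberField IsDedekindDomain Set MulAction Filter Matrix
open scoped ENNReal NNReal ComplexConjugate MatrixGroups
open Literature.MeasureTheory.Group Literature.NumberTheory
open Literature.NumberTheory.Automorphic Literature.NumberTheory.Automorphic.UnitaryGroup AdelicGroupData
open Summit.HodgeConjecture.HodgeConjecture.Cruxes.H413.K2E1BorelEisensteinU
open Summit.HodgeConjecture.HodgeConjecture.Cruxes.H413.K2E1MaassSelbergBracketsThree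
open Summit.HodgeConjecture.HodgeConjecture.Cruxes.H413.K2E1IntertwiningGrowthU3
open Summit.HodgeConjecture.HodgeConjecture.Cruxes.H413.K2E1HeightFunctionU3 (borelHeight_one)
open Summit.HodgeConjecture.HodgeConjecture.Cruxes.H413.K2E1MaassSelbergCMThreeFinal (maassSelberg_flatSectionU_cm_three_final')

namespace Summit.HodgeConjecture.HodgeConjecture.Cruxes.H413.K2E1MaassSelbergSphericalBracketsCMThree

/-! ## §1 The complex-exponent standard intertwining integral of `U(J₃)`: `∫ H(w₀ v g)^w dν = c(w)·H(g)^{2−w}`, `w : ℂ` -/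

section Generic

variable {F E : Type} [Field F] [NumberField F] [Field E] [NumberField E] [Algebra F E] {c : E ≃ₐ[F] E}
variable [MeasurableSpace (quasiSplit F E c 3).Adelic] [BorelSpace (quasiSplit F E c 3).Adelic]

/-- **`∫ H(w₀ v t x)^w dν(v) = δ_B(t) · ‖d₀‖^{−w} · ∫ H(w₀ v x)^w dν(v)`** for `t = diag(d) ∈ T(𝔸_F)` and COMPLEX `w` (the ℂ-twin of ★ [D8] `integral_borelHeight_weylLongU_torus_mul_rpow`:
substitute `v = t u t⁻¹`, ★ `map_torusConj_eq_torusRootModulus_smul`, and ★ [D8] §1 `H(w₀ t x) = ‖d₀‖⁻¹ H(w₀ x)` pointwise with `Complex.mul_cpow_ofReal_nonneg`).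
[cite: MoeglinWaldspurger1995, II.1.6] [cite: Garrett2018, §2.8] -/
theorem integral_borelHeight_weylLongU_torus_mul_cpow (hc : c * c = 1) (hc1 : c ≠ 1) (ν : Measure ↥(adelicUnipotent F E c 3)) [ν.IsHaarMeasure]
    (t : torusInBorel F E c 3) {d : Fin 3 → (AdeleRing (𝓞 E) E)ˣ}
    (hd : glDiagonal 3 (AdeleRing (𝓞 E) E) d = adelicVal F E c 3 _ ((t : borelAdelic F E c 3) : (quasiSplit F E c 3).Adelic)) (w : ℂ) (x : (quasiSplit F E c 3).Adelic) :
    ∫ v : ↥(adelicUnipotent F E c 3), (((borelHeight ((quasiSplit F E c 3).toAdelic (weylLongU (c : E →+* E) (rfl : (StdForm.antidiagonal 3).over E = (StdForm.antidiagonal 3).over E)) * ((v : (quasiSplit F E c 3).Adelic) * (((t : borelAdelic F E c 3) : (quasiSplit F E c 3).Adelic) * x)))) : ℝ) : ℂ) ^ w ∂ν =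
      ((torusRootModulus E 3 d : ℝ) : ℂ) * ((((IdeleClassGroup.ideleNorm E (d 0) : ℝ) : ℂ) ^ w)⁻¹ *
        ∫ v : ↥(adelicUnipotent F E c 3), (((borelHeight ((quasiSplit F E c 3).toAdelic (weylLongU (c : E →+* E) (rfl : (StdForm.antidiagonal 3).over E = (StdForm.antidiagonal 3).over E)) * ((v : (quasiSplit F E c 3).Adelic) * x))) : ℝ) : ℂ) ^ w ∂ν) := by
  set T : (quasiSplit F E c 3).Adelic := ((t : borelAdelic F E c 3) : (quasiSplit F E c 3).Adelic) with hT
  -- the integrand as a function of `u = t⁻¹ v t`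
  set Φ : ↥(adelicUnipotent F E c 3) → ℂ := fun u => (((borelHeight ((quasiSplit F E c 3).toAdelic (weylLongU (c : E →+* E) (rfl : (StdForm.antidiagonal 3).over E = (StdForm.antidiagonal 3).over E)) * (T * ((u : (quasiSplit F E c 3).Adelic) * x)))) : ℝ) : ℂ) ^ w with hΦ
  have hΦm : Measurable Φ :=
    (Complex.measurable_ofReal.comp (measurable_borelHeight.comp (continuous_const.mul (continuous_const.mul (continuous_subtype_val.mul continuous_const))).measurable).coe_nnreal_real).pow_const w
  have hκ : Measurable fun u : ↥(adelicUnipotent F E c 3) => (⟨T⁻¹ * (u : (quasiSplit F E c 3).Adelic) * T, conj_mem_adelicUnipotent (t : borelAdelic F E c 3).2 u.2⟩ : ↥(adelicUnipotent F E c 3)) :=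
    ((continuous_const.mul continuous_subtype_val).mul continuous_const).measurable.subtype_mk
  have h1 : (fun v : ↥(adelicUnipotent F E c 3) => (((borelHeight ((quasiSplit F E c 3).toAdelic (weylLongU (c : E →+* E) (rfl : (StdForm.antidiagonal 3).over E = (StdForm.antidiagonal 3).over E)) * ((v : (quasiSplit F E c 3).Adelic) * (T * x)))) : ℝ) : ℂ) ^ w) =
      fun v : ↥(adelicUnipotent F E c 3) => Φ (⟨T⁻¹ * (v : (quasiSplit F E c 3).Adelic) * T, conj_mem_adelicUnipotent (t : borelAdelic F E c 3).2 v.2⟩ : ↥(adelicUnipotent F E c 3)) := by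
    funext v
    simp only [hΦ]
    rw [show T * (T⁻¹ * (v : (quasiSplit F E c 3).Adelic) * T * x) = (v : (quasiSplit F E c 3).Adelic) * (T * x) by group]
  have hpos : (0 : ℝ) < (IdeleClassGroup.ideleNorm E (d 0) : ℝ) := ideleNorm_real_pos _
  have harg : (((IdeleClassGroup.ideleNorm E (d 0) : ℝ) : ℂ)).arg ≠ Real.pi := by
    rw [Complex.arg_ofReal_of_nonneg hpos.le]; exact Real.pi_ne_zero.symm
  have h2 : ∀ u : ↥(adelicUnipotent F E c 3), Φ u = (((IdeleClassGroup.ideleNorm E (d 0) : ℝ) : ℂ) ^ w)⁻¹ * (((borelHeight ((quasiSplit F E c 3).toAdelic (weylLongU (c : E →+* E) (rfl : (StdForm.antidiagonal 3).over E = (StdForm.antidiagonal 3).over E)) * ((u : (quasiSplit F E c 3).Adelic) * x))) : ℝ) : ℂ) ^ w := by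
    intro u
    simp only [hΦ]
    rw [borelHeight_weylLongU_mul_diag_mul hd, NNReal.coe_mul, NNReal.coe_inv, Complex.ofReal_mul,
      Complex.mul_cpow_ofReal_nonneg (inv_nonneg.2 (NNReal.coe_nonneg _)) (NNReal.coe_nonneg _), Complex.ofReal_inv, Complex.inv_cpow _ _ harg]
  rw [h1, ← integral_map hκ.aemeasurable hΦm.aestronglyMeasurable, map_torusConj_eq_torusRootModulus_smul hc hc1 ν t hd, integral_smul_measure,
    ENNReal.coe_toReal]
  simp_rw [h2]
  rw [integral_const_mul, Complex.real_smul]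

/-- **THE COMPLEX-EXPONENT STANDARD INTERTWINING INTEGRAL OF `U(J₃)`**: `∫_{N(𝔸)} H(w₀ v g)^w dν(v) = c(w)·H(g)^{2−w}`, `c(w) := ∫_{N(𝔸)} H(w₀ v)^w dν(v) ∈ ℂ`, for every `g` and every
`w : ℂ` (the ℂ-twin of ★ [D8] `integral_borelHeight_weylLongU_mul_rpow_eq`: Iwasawa `g = b k` ★ `hBK` and right-`K_U`-invariance of `H` ★; Levi `b = t n` ★ `torusPart`; the torus scaling above;
`N(𝔸)` unimodular ★; `δ_B(t) = ‖d₀‖²`, `H(b) = ‖d₀‖` ★ torus relations).  No convergence hypothesis: both sides carry the same Bochner junk. [cite: MoeglinWaldspurger1995, II.1.6]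
[cite: Garrett2018, §2.8] [cite: Rogawski1990, §2.2] -/
theorem integral_borelHeight_weylLongU_mul_cpow_eq (hc : c * c = 1) (hc1 : c ≠ 1) (ν : Measure ↥(adelicUnipotent F E c 3)) [ν.IsHaarMeasure]
    (hBK : ∀ g : (quasiSplit F E c 3).Adelic, ∃ b ∈ borelAdelic F E c 3, ∃ k : (quasiSplit F E c 3).Adelic, adelicVal F E c 3 ((StdForm.antidiagonal 3).over E) k ∈ standardMaximalCompactGL 3 E ∧ g = b * k)
    (w : ℂ) (g : (quasiSplit F E c 3).Adelic) :
    ∫ v : ↥(adelicUnipotent F E c 3), (((borelHeight ((quasiSplit F E c 3).toAdelic (weylLongU (c : E →+* E) (rfl : (StdForm.antidiagonal 3).over E = (StdForm.antidiagonal 3).over E)) * ((v : (quasiSplit F E c 3).Adelic) * g))) : ℝ) : ℂ) ^ w ∂ν =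
      (∫ v : ↥(adelicUnipotent F E c 3), (((borelHeight ((quasiSplit F E c 3).toAdelic (weylLongU (c : E →+* E) (rfl : (StdForm.antidiagonal 3).over E = (StdForm.antidiagonal 3).over E)) * (v : (quasiSplit F E c 3).Adelic))) : ℝ) : ℂ) ^ w ∂ν) * ((borelHeight g : ℝ) : ℂ) ^ (2 - w) := by
  haveI := locallyCompactSpace_adeleRing' E
  haveI := isMulRightInvariant_of_isHaarMeasure_adelicUnipotent_three hc ν
  obtain ⟨b, hb, k, hk, rfl⟩ := hBK g
  have hkK : k ∈ ((standardMaximalCompactGL 3 E).comap (adelicVal F E c 3 ((StdForm.antidiagonal 3).over E)) : Subgroup (quasiSplit F E c 3).Adelic) := Subgroup.mem_comap.2 hk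
  -- strip `k`
  have e1 : ∀ v : ↥(adelicUnipotent F E c 3), borelHeight ((quasiSplit F E c 3).toAdelic (weylLongU (c : E →+* E) (rfl : (StdForm.antidiagonal 3).over E = (StdForm.antidiagonal 3).over E)) * ((v : (quasiSplit F E c 3).Adelic) * (b * k))) = borelHeight ((quasiSplit F E c 3).toAdelic (weylLongU (c : E →+* E) (rfl : (StdForm.antidiagonal 3).over E = (StdForm.antidiagonal 3).over E)) * ((v : (quasiSplit F E c 3).Adelic) * b)) := fun v => by
    rw [show (quasiSplit F E c 3).toAdelic (weylLongU (c : E →+* E) (rfl : (StdForm.antidiagonal 3).over E = (StdForm.antidiagonal 3).over E)) * ((v : (quasiSplit F E c 3).Adelic) * (b * k)) = (quasiSplit F E c 3).toAdelic (weylLongU (c : E →+* E) (rfl : (StdForm.antidiagonal 3).over E = (StdForm.antidiagonal 3).over E)) * ((v : (quasiSplit F E c 3).Adelic) * b) * k by group]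
    exact borelHeight_mul_of_mem_comap_standardMaximalCompactGL hkK _
  simp_rw [e1]
  rw [borelHeight_mul_of_mem_comap_standardMaximalCompactGL hkK b]
  -- Levi `b = t n`
  set tB : torusInBorel F E c 3 := ⟨torusPart ⟨b, hb⟩, (mem_torusInBorel_iff _).2 (torusPart_mem_torusAdelic _)⟩ with htB
  have hd : glDiagonal 3 (AdeleRing (𝓞 E) E) (diagUnit hb) = adelicVal F E c 3 _ ((tB : borelAdelic F E c 3) : (quasiSplit F E c 3).Adelic) := (adelicVal_torusPart ⟨b, hb⟩).symm
  have hn : (((tB : borelAdelic F E c 3) : (quasiSplit F E c 3).Adelic))⁻¹ * b ∈ adelicUnipotent F E c 3 := torusPart_inv_mul_mem_adelicUnipotent ⟨b, hb⟩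
  have key := integral_borelHeight_weylLongU_torus_mul_cpow hc hc1 ν tB hd w ((((tB : borelAdelic F E c 3) : (quasiSplit F E c 3).Adelic))⁻¹ * b)
  rw [mul_inv_cancel_left] at key
  -- `N(𝔸)` unimodular: right-translate by `n`
  have e2 : ∫ v : ↥(adelicUnipotent F E c 3), (((borelHeight ((quasiSplit F E c 3).toAdelic (weylLongU (c : E →+* E) (rfl : (StdForm.antidiagonal 3).over E = (StdForm.antidiagonal 3).over E)) * ((v : (quasiSplit F E c 3).Adelic) * ((((tB : borelAdelic F E c 3) : (quasiSplit F E c 3).Adelic))⁻¹ * b)))) : ℝ) : ℂ) ^ w ∂ν =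
      ∫ v : ↥(adelicUnipotent F E c 3), (((borelHeight ((quasiSplit F E c 3).toAdelic (weylLongU (c : E →+* E) (rfl : (StdForm.antidiagonal 3).over E = (StdForm.antidiagonal 3).over E)) * (v : (quasiSplit F E c 3).Adelic))) : ℝ) : ℂ) ^ w ∂ν := by
    have h := integral_mul_right_eq_self (μ := ν) (fun v : ↥(adelicUnipotent F E c 3) => (((borelHeight ((quasiSplit F E c 3).toAdelic (weylLongU (c : E →+* E) (rfl : (StdForm.antidiagonal 3).over E = (StdForm.antidiagonal 3).over E)) * (v : (quasiSplit F E c 3).Adelic))) : ℝ) : ℂ) ^ w) ⟨_, hn⟩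
    simpa only [Subgroup.coe_mul] using h
  rw [key, e2]
  -- torus relations: `δ_B(t) = ‖d₀‖²`, `H(b) = H(t n) = ‖d₂‖⁻¹ = ‖d₀‖`
  have hδ : (torusRootModulus E 3 (diagUnit hb) : ℝ) = (IdeleClassGroup.ideleNorm E (diagUnit hb 0) : ℝ) * (IdeleClassGroup.ideleNorm E (diagUnit hb 0) : ℝ) := by
    rw [torusRootModulus_three_eq tB hd, AdeleRing.distribHaarChar_eq_ideleNorm, NNReal.coe_mul]
  have hHb : (borelHeight b : ℝ) = (IdeleClassGroup.ideleNorm E (diagUnit hb 0) : ℝ) := by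
    have h2 := (distribHaarChar_torus_three tB hd).2
    rw [AdeleRing.distribHaarChar_eq_ideleNorm, AdeleRing.distribHaarChar_eq_ideleNorm] at h2
    have hlast : lastEntryUnit (tB : borelAdelic F E c 3).2 = diagUnit hb 2 := Units.ext (coe_lastEntryUnit_of_glDiagonal_eq hd)
    conv_lhs => rw [← mul_inv_cancel_left (((tB : borelAdelic F E c 3) : (quasiSplit F E c 3).Adelic)) b, borelHeight_borel_mul (tB : borelAdelic F E c 3).2,
      show (((tB : borelAdelic F E c 3) : (quasiSplit F E c 3).Adelic))⁻¹ * b = ((((tB : borelAdelic F E c 3) : (quasiSplit F E c 3).Adelic))⁻¹ * b) * 1 from (mul_one _).symm,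
      borelHeight_unipotent_mul hn, borelHeight_one, mul_one, hlast, h2, inv_inv]
  have hpos : (0 : ℝ) < (IdeleClassGroup.ideleNorm E (diagUnit hb 0) : ℝ) := ideleNorm_real_pos _
  have ha0 : ((IdeleClassGroup.ideleNorm E (diagUnit hb 0) : ℝ) : ℂ) ≠ 0 := Complex.ofReal_ne_zero.2 hpos.ne'
  have haw : ((IdeleClassGroup.ideleNorm E (diagUnit hb 0) : ℝ) : ℂ) ^ w ≠ 0 := fun h => ha0 ((Complex.cpow_eq_zero_iff _ _).1 h).1
  rw [show ((torusRootModulus E 3 (diagUnit hb) : ℝ) : ℂ) = ((IdeleClassGroup.ideleNorm E (diagUnit hb 0) : ℝ) : ℂ) * ((IdeleClassGroup.ideleNorm E (diagUnit hb 0) : ℝ) : ℂ) by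
      rw [hδ, Complex.ofReal_mul], hHb, Complex.cpow_sub _ _ ha0, Complex.cpow_two]
  field_simp

/-! ## §2 The intertwined coefficient of a CONSTANT section is the constant `c(z)·φ₀` -/

/-- **`φ̃ ≡ c(z)·φ₀` FOR `φ ≡ φ₀`**: `(∫_{N(𝔸)} φ₀·H(w₀ v g)^z dν(v))·H(g)^{z−2} = φ₀·c(z)·H(g)^{(2−z)+(z−2)} = c(z)·φ₀` (§1 and `H(g) ≠ 0`) — the intertwined coefficient of ★ ED. 5 at the
spherical vector. [cite: MoeglinWaldspurger1995, II.1.6] [cite: Garrett2018, §2.8] -/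
theorem intertwinedCoeff_const (hc : c * c = 1) (hc1 : c ≠ 1) (ν : Measure ↥(adelicUnipotent F E c 3)) [ν.IsHaarMeasure]
    (hBK : ∀ g : (quasiSplit F E c 3).Adelic, ∃ b ∈ borelAdelic F E c 3, ∃ k : (quasiSplit F E c 3).Adelic, adelicVal F E c 3 ((StdForm.antidiagonal 3).over E) k ∈ standardMaximalCompactGL 3 E ∧ g = b * k)
    (φ₀ z : ℂ) (g : (quasiSplit F E c 3).Adelic) :
    (∫ v : ↥(adelicUnipotent F E c 3), flatSectionU (fun _ : (quasiSplit F E c 3).Adelic => φ₀) z ((quasiSplit F E c 3).toAdelic (weylLongU (c : E →+* E) (rfl : (StdForm.antidiagonal 3).over E = (StdForm.antidiagonal 3).over E)) * ((v : (quasiSplit F E c 3).Adelic) * g)) ∂ν) * ((borelHeight g : ℝ) : ℂ) ^ (z - 2) =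
      (∫ v : ↥(adelicUnipotent F E c 3), (((borelHeight ((quasiSplit F E c 3).toAdelic (weylLongU (c : E →+* E) (rfl : (StdForm.antidiagonal 3).over E = (StdForm.antidiagonal 3).over E)) * (v : (quasiSplit F E c 3).Adelic))) : ℝ) : ℂ) ^ z ∂ν) * φ₀ := by
  have hne : ((borelHeight g : ℝ) : ℂ) ≠ 0 := Complex.ofReal_ne_zero.2 (ne_of_gt (by exact_mod_cast borelHeight_pos g))
  simp only [flatSectionU_apply]
  rw [integral_const_mul, integral_borelHeight_weylLongU_mul_cpow_eq hc hc1 ν hBK z g, mul_assoc, mul_assoc, ← Complex.cpow_add _ _ hne,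
    show (2 : ℂ) - z + (z - 2) = 0 by ring, Complex.cpow_zero, mul_one, mul_comm]

/-! ## §3 The four `K_U`-averages at constant coefficients are constants (`m := μ_K(K_U)`, finite: `K_U` compact ★) -/

omit [BorelSpace (quasiSplit F E c 3).Adelic] in
/-- `K_U` is compact (★ `isCompact_comap_adelicVal_standardMaximalCompactGL`), so a Haar measure `μ_K` on it is finite and `∫_{K_U} C dμ_K = μ_K(K_U)·C`. [folklore] -/
theorem integral_maximalCompact_const (μK : Measure ((standardMaximalCompactGL 3 E).comap (adelicVal F E c 3 ((StdForm.antidiagonal 3).over E)) : Subgroup (quasiSplit F E c 3).Adelic)) [μK.IsHaarMeasure] (C : ℂ) :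
    ∫ _ : ((standardMaximalCompactGL 3 E).comap (adelicVal F E c 3 ((StdForm.antidiagonal 3).over E)) : Subgroup (quasiSplit F E c 3).Adelic), C ∂μK = ((μK.real Set.univ : ℝ) : ℂ) * C := by
  have hKc : IsCompact (((standardMaximalCompactGL 3 E).comap (adelicVal F E c 3 ((StdForm.antidiagonal 3).over E)) : Subgroup (quasiSplit F E c 3).Adelic) : Set (quasiSplit F E c 3).Adelic) :=
    isCompact_comap_adelicVal_standardMaximalCompactGL
  haveI : CompactSpace ((standardMaximalCompactGL 3 E).comap (adelicVal F E c 3 ((StdForm.antidiagonal 3).over E)) : Subgroup (quasiSplit F E c 3).Adelic) := isCompact_iff_compactSpace.1 hKc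
  haveI : IsFiniteMeasure μK := CompactSpace.isFiniteMeasure
  rw [integral_const, Complex.real_smul]

omit [BorelSpace (quasiSplit F E c 3).Adelic] in
/-- **`Ξ₁ ≡ m·φ₀·conj φ₀′`**: the `K_U`-average of `φ·conj φ′` along `t·K_U` at constant coefficients (the `hΞ₁` datum of ★ ED. 6 ∕ «CM-FINAL»). [cite: MoeglinWaldspurger1995, II.1.7] -/
theorem average_const_mul_conj_const (μK : Measure ((standardMaximalCompactGL 3 E).comap (adelicVal F E c 3 ((StdForm.antidiagonal 3).over E)) : Subgroup (quasiSplit F E c 3).Adelic)) [μK.IsHaarMeasure]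
    (φ₀ φ₀' : ℂ) (t : torusInBorel F E c 3) :
    ∫ _ : ((standardMaximalCompactGL 3 E).comap (adelicVal F E c 3 ((StdForm.antidiagonal 3).over E)) : Subgroup (quasiSplit F E c 3).Adelic), φ₀ * conj φ₀' ∂μK =
      (fun _ : (AdeleRing (𝓞 E) E)ˣ => ((μK.real Set.univ : ℝ) : ℂ) * (φ₀ * conj φ₀')) (diagUnit (t : borelAdelic F E c 3).2 0) :=
  integral_maximalCompact_const μK _

/-- **`Ξ₂ ≡ m·φ₀·conj(c(z′)·φ₀′)`**: the `K_U`-average of `φ·conj φ̃′` along `t·K_U` at constant coefficients — `φ̃′ ≡ c(z′)·φ₀′` by §2 (the `hΞ₂` datum, ED. 6's integrand shape).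
[cite: MoeglinWaldspurger1995, II.1.7] -/
theorem average_const_mul_conj_intertwinedCoeff_const (hc : c * c = 1) (hc1 : c ≠ 1) (ν : Measure ↥(adelicUnipotent F E c 3)) [ν.IsHaarMeasure]
    (hBK : ∀ g : (quasiSplit F E c 3).Adelic, ∃ b ∈ borelAdelic F E c 3, ∃ k : (quasiSplit F E c 3).Adelic, adelicVal F E c 3 ((StdForm.antidiagonal 3).over E) k ∈ standardMaximalCompactGL 3 E ∧ g = b * k)
    (μK : Measure ((standardMaximalCompactGL 3 E).comap (adelicVal F E c 3 ((StdForm.antidiagonal 3).over E)) : Subgroup (quasiSplit F E c 3).Adelic)) [μK.IsHaarMeasure]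
    (φ₀ φ₀' z' : ℂ) (t : torusInBorel F E c 3) :
    ∫ k : ((standardMaximalCompactGL 3 E).comap (adelicVal F E c 3 ((StdForm.antidiagonal 3).over E)) : Subgroup (quasiSplit F E c 3).Adelic),
        φ₀ * conj ((∫ v : ↥(adelicUnipotent F E c 3), flatSectionU (fun _ : (quasiSplit F E c 3).Adelic => φ₀') z' ((quasiSplit F E c 3).toAdelic (weylLongU (c : E →+* E) (rfl : (StdForm.antidiagonal 3).over E = (StdForm.antidiagonal 3).over E)) * ((v : (quasiSplit F E c 3).Adelic) * (((t : borelAdelic F E c 3) : (quasiSplit F E c 3).Adelic) * (k : (quasiSplit F E c 3).Adelic)))) ∂ν) *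
          ((borelHeight (((t : borelAdelic F E c 3) : (quasiSplit F E c 3).Adelic) * (k : (quasiSplit F E c 3).Adelic)) : ℝ) : ℂ) ^ (z' - 2)) ∂μK =
      (fun _ : (AdeleRing (𝓞 E) E)ˣ => ((μK.real Set.univ : ℝ) : ℂ) * (φ₀ * conj ((∫ v : ↥(adelicUnipotent F E c 3), (((borelHeight ((quasiSplit F E c 3).toAdelic (weylLongU (c : E →+* E) (rfl : (StdForm.antidiagonal 3).over E = (StdForm.antidiagonal 3).over E)) * (v : (quasiSplit F E c 3).Adelic))) : ℝ) : ℂ) ^ z' ∂ν) * φ₀')))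
        (diagUnit (t : borelAdelic F E c 3).2 0) := by
  simp_rw [intertwinedCoeff_const hc hc1 ν hBK φ₀' z']
  exact integral_maximalCompact_const μK _

/-- **`Ξ₃ ≡ m·c(z)φ₀·conj φ₀′`**: the `K_U`-average of `φ̃·conj φ′` along `t·K_U` at constant coefficients (the `hΞ₃` datum, ED. 6's integrand shape). [cite: MoeglinWaldspurger1995, II.1.7] -/
theorem average_intertwinedCoeff_const_mul_conj_const (hc : c * c = 1) (hc1 : c ≠ 1) (ν : Measure ↥(adelicUnipotent F E c 3)) [ν.IsHaarMeasure]
    (hBK : ∀ g : (quasiSplit F E c 3).Adelic, ∃ b ∈ borelAdelic F E c 3, ∃ k : (quasiSplit F E c 3).Adelic, adelicVal F E c 3 ((StdForm.antidiagonal 3).over E) k ∈ standardMaximalCompactGL 3 E ∧ g = b * k)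
    (μK : Measure ((standardMaximalCompactGL 3 E).comap (adelicVal F E c 3 ((StdForm.antidiagonal 3).over E)) : Subgroup (quasiSplit F E c 3).Adelic)) [μK.IsHaarMeasure]
    (φ₀ φ₀' z : ℂ) (t : torusInBorel F E c 3) :
    ∫ k : ((standardMaximalCompactGL 3 E).comap (adelicVal F E c 3 ((StdForm.antidiagonal 3).over E)) : Subgroup (quasiSplit F E c 3).Adelic),
        (∫ v : ↥(adelicUnipotent F E c 3), flatSectionU (fun _ : (quasiSplit F E c 3).Adelic => φ₀) z ((quasiSplit F E c 3).toAdelic (weylLongU (c : E →+* E) (rfl : (StdForm.antidiagonal 3).over E = (StdForm.antidiagonal 3).over E)) * ((v : (quasiSplit F E c 3).Adelic) * (((t : borelAdelic F E c 3) : (quasiSplit F E c 3).Adelic) * (k : (quasiSplit F E c 3).Adelic)))) ∂ν) *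
          ((borelHeight (((t : borelAdelic F E c 3) : (quasiSplit F E c 3).Adelic) * (k : (quasiSplit F E c 3).Adelic)) : ℝ) : ℂ) ^ (z - 2) * conj φ₀' ∂μK =
      (fun _ : (AdeleRing (𝓞 E) E)ˣ => ((μK.real Set.univ : ℝ) : ℂ) * ((∫ v : ↥(adelicUnipotent F E c 3), (((borelHeight ((quasiSplit F E c 3).toAdelic (weylLongU (c : E →+* E) (rfl : (StdForm.antidiagonal 3).over E = (StdForm.antidiagonal 3).over E)) * (v : (quasiSplit F E c 3).Adelic))) : ℝ) : ℂ) ^ z ∂ν) * φ₀ * conj φ₀'))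
        (diagUnit (t : borelAdelic F E c 3).2 0) := by
  simp_rw [intertwinedCoeff_const hc hc1 ν hBK φ₀ z]
  exact integral_maximalCompact_const μK _

/-- **`Ξ₄ ≡ m·c(z)φ₀·conj(c(z′)φ₀′)`**: the `K_U`-average of `φ̃·conj φ̃′` along `t·K_U` at constant coefficients (the `hΞ₄` datum, ED. 6's integrand shape). [cite: MoeglinWaldspurger1995, II.1.7] -/
theorem average_intertwinedCoeff_const_mul_conj_intertwinedCoeff_const (hc : c * c = 1) (hc1 : c ≠ 1) (ν : Measure ↥(adelicUnipotent F E c 3)) [ν.IsHaarMeasure]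
    (hBK : ∀ g : (quasiSplit F E c 3).Adelic, ∃ b ∈ borelAdelic F E c 3, ∃ k : (quasiSplit F E c 3).Adelic, adelicVal F E c 3 ((StdForm.antidiagonal 3).over E) k ∈ standardMaximalCompactGL 3 E ∧ g = b * k)
    (μK : Measure ((standardMaximalCompactGL 3 E).comap (adelicVal F E c 3 ((StdForm.antidiagonal 3).over E)) : Subgroup (quasiSplit F E c 3).Adelic)) [μK.IsHaarMeasure]
    (φ₀ φ₀' z z' : ℂ) (t : torusInBorel F E c 3) :
    ∫ k : ((standardMaximalCompactGL 3 E).comap (adelicVal F E c 3 ((StdForm.antidiagonal 3).over E)) : Subgroup (quasiSplit F E c 3).Adelic),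
        (∫ v : ↥(adelicUnipotent F E c 3), flatSectionU (fun _ : (quasiSplit F E c 3).Adelic => φ₀) z ((quasiSplit F E c 3).toAdelic (weylLongU (c : E →+* E) (rfl : (StdForm.antidiagonal 3).over E = (StdForm.antidiagonal 3).over E)) * ((v : (quasiSplit F E c 3).Adelic) * (((t : borelAdelic F E c 3) : (quasiSplit F E c 3).Adelic) * (k : (quasiSplit F E c 3).Adelic)))) ∂ν) *
          ((borelHeight (((t : borelAdelic F E c 3) : (quasiSplit F E c 3).Adelic) * (k : (quasiSplit F E c 3).Adelic)) : ℝ) : ℂ) ^ (z - 2) *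
        conj ((∫ v : ↥(adelicUnipotent F E c 3), flatSectionU (fun _ : (quasiSplit F E c 3).Adelic => φ₀') z' ((quasiSplit F E c 3).toAdelic (weylLongU (c : E →+* E) (rfl : (StdForm.antidiagonal 3).over E = (StdForm.antidiagonal 3).over E)) * ((v : (quasiSplit F E c 3).Adelic) * (((t : borelAdelic F E c 3) : (quasiSplit F E c 3).Adelic) * (k : (quasiSplit F E c 3).Adelic)))) ∂ν) *
          ((borelHeight (((t : borelAdelic F E c 3) : (quasiSplit F E c 3).Adelic) * (k : (quasiSplit F E c 3).Adelic)) : ℝ) : ℂ) ^ (z' - 2)) ∂μK =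
      (fun _ : (AdeleRing (𝓞 E) E)ˣ => ((μK.real Set.univ : ℝ) : ℂ) *
          ((∫ v : ↥(adelicUnipotent F E c 3), (((borelHeight ((quasiSplit F E c 3).toAdelic (weylLongU (c : E →+* E) (rfl : (StdForm.antidiagonal 3).over E = (StdForm.antidiagonal 3).over E)) * (v : (quasiSplit F E c 3).Adelic))) : ℝ) : ℂ) ^ z ∂ν) * φ₀ * conj ((∫ v : ↥(adelicUnipotent F E c 3), (((borelHeight ((quasiSplit F E c 3).toAdelic (weylLongU (c : E →+* E) (rfl : (StdForm.antidiagonal 3).over E = (StdForm.antidiagonal 3).over E)) * (v : (quasiSplit F E c 3).Adelic))) : ℝ) : ℂ) ^ z' ∂ν) * φ₀')))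
        (diagUnit (t : borelAdelic F E c 3).2 0) := by
  simp_rw [intertwinedCoeff_const hc hc1 ν hBK φ₀ z, intertwinedCoeff_const hc hc1 ν hBK φ₀' z']
  exact integral_maximalCompact_const μK _


/-! ## §3b The idele-class bracket `κ = ∫_{𝓕_I ∩ {‖x‖ ≤ 1}} ‖x‖ dν_I` is positive (Tate) -/

section Bracket

variable [MeasurableSpace (AdeleRing (𝓞 E) E)ˣ] [BorelSpace (AdeleRing (𝓞 E) E)ˣ]

omit [MeasurableSpace (quasiSplit F E c 3).Adelic] [BorelSpace (quasiSplit F E c 3).Adelic] in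
/-- **`κ := ∫_{𝓕_I ∩ {‖x‖ ≤ 1}} ‖x‖ dν_I > 0`** (the complex bracket of §4 is `↑κ` by Mathlib `integral_ofReal`): Tate's cut-off integral ★ `setLIntegral_indicator_ideleNorm_rpow_eq` at `σ = 1`,
`C₀ = 1` gives `κ = V`, the idelic covolume, and `0 < V < ∞` (★ `idelicCovolume_ne_zero`, ★ `idelicCovolume_ne_top`). [cite: CasselsFrohlichANT1967, Ch. XV Thm. 4.1.3] -/
theorem idelicBracket_pos (νI : Measure (AdeleRing (𝓞 E) E)ˣ) [νI.IsHaarMeasure] {𝓕I : Set (AdeleRing (𝓞 E) E)ˣ} (h𝓕I : IsIdeleClassDomain E 𝓕I) :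
    0 < ∫ x in {x : (AdeleRing (𝓞 E) E)ˣ | (IdeleClassGroup.ideleNorm E x : ℝ) ≤ 1} ∩ 𝓕I, (IdeleClassGroup.ideleNorm E x : ℝ) ∂νI := by
  have hIm : Measurable fun x : (AdeleRing (𝓞 E) E)ˣ => (IdeleClassGroup.ideleNorm E x : ℝ) := (continuous_ideleNorm_holds E).measurable.coe_nnreal_real
  have hS : MeasurableSet {x : (AdeleRing (𝓞 E) E)ˣ | (IdeleClassGroup.ideleNorm E x : ℝ) ≤ 1} := measurableSet_le hIm measurable_const
  rw [← Measure.restrict_restrict hS, ← integral_indicator hS,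
    integral_eq_lintegral_of_nonneg_ae (Eventually.of_forall fun x => Set.indicator_nonneg (fun _ _ => NNReal.coe_nonneg _) _) ((hIm.indicator hS).aestronglyMeasurable)]
  have hpt : ∀ x : (AdeleRing (𝓞 E) E)ˣ, ENNReal.ofReal ({x : (AdeleRing (𝓞 E) E)ˣ | (IdeleClassGroup.ideleNorm E x : ℝ) ≤ 1}.indicator (fun x => (IdeleClassGroup.ideleNorm E x : ℝ)) x) =
      {x : (AdeleRing (𝓞 E) E)ˣ | IdeleClassGroup.ideleNorm E x ≤ (1 : ℝ≥0)}.indicator (fun x => ENNReal.ofReal ((IdeleClassGroup.ideleNorm E x : ℝ) ^ (1 : ℝ))) x := by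
    intro x
    by_cases hx : (IdeleClassGroup.ideleNorm E x : ℝ) ≤ 1
    · have hx' : IdeleClassGroup.ideleNorm E x ≤ (1 : ℝ≥0) := by exact_mod_cast hx
      rw [indicator_of_mem (show x ∈ {x : (AdeleRing (𝓞 E) E)ˣ | (IdeleClassGroup.ideleNorm E x : ℝ) ≤ 1} from hx),
        indicator_of_mem (show x ∈ {x : (AdeleRing (𝓞 E) E)ˣ | IdeleClassGroup.ideleNorm E x ≤ (1 : ℝ≥0)} from hx'), Real.rpow_one]
    · have hx' : ¬ IdeleClassGroup.ideleNorm E x ≤ (1 : ℝ≥0) := fun h => hx (by exact_mod_cast h)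
      rw [indicator_of_notMem (show x ∉ {x : (AdeleRing (𝓞 E) E)ˣ | (IdeleClassGroup.ideleNorm E x : ℝ) ≤ 1} from hx),
        indicator_of_notMem (show x ∉ {x : (AdeleRing (𝓞 E) E)ˣ | IdeleClassGroup.ideleNorm E x ≤ (1 : ℝ≥0)} from hx'), ENNReal.ofReal_zero]
  simp_rw [hpt]
  rw [K2E1BorelParabolicIntegralU3.setLIntegral_indicator_ideleNorm_rpow_eq E νI h𝓕I one_pos 1, NNReal.coe_one, Real.one_rpow, div_one, ENNReal.ofReal_one, mul_one]
  exact ENNReal.toReal_pos (idelicCovolume_ne_zero νI) (idelicCovolume_ne_top νI)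

end Bracket

end Generic

/-! ## §4 The CM pair: «CM-FINAL» at the spherical sections — every `hΞᵢ` discharged, the brackets explicit, survivor `hdec′` ONLY -/

section CM

variable (L : Type) [Field L] [NumberField L] [IsCMField L]
variable [MeasurableSpace (quasiSplit (↥(maximalRealSubfield L)) L (IsCMField.complexConj L) 3).Adelic] [BorelSpace (quasiSplit (↥(maximalRealSubfield L)) L (IsCMField.complexConj L) 3).Adelic]
variable [MeasurableSpace (AdeleRing (𝓞 L) L)ˣ] [BorelSpace (AdeleRing (𝓞 L) L)ˣ]

/-- **THE MAASS–SELBERG RELATION FOR THE SPHERICAL FLAT SECTIONS `φ₀·H^z`, `φ₀′·H^{z′}` OF `U(J₃)` AT THE CM PAIR** = ★ «CM-FINAL» ED. 2 `maassSelberg_flatSectionU_cm_three_final′` at the CONSTANT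
coefficients `φ ≡ φ₀`, `φ′ ≡ φ₀′` with ALL FOUR `K_U`-average data `hΞᵢ` DISCHARGED (§3: `Ξ₁ ≡ m·φ₀·conj φ₀′`, `Ξ₂ ≡ m·φ₀·conj(c(z′)φ₀′)`, `Ξ₃ ≡ m·c(z)φ₀·conj φ₀′`, `Ξ₄ ≡ m·c(z)φ₀·conj(c(z′)φ₀′)`,
`m = μ_K(K_U)`, `c(w) = ∫_{N(𝔸)} H(w₀ v)^w dν` the complex-exponent standard intertwining integral of §1; Borel∕bounded∕invariant trivially) and the idele-class brackets EXPLICIT,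
`[Ξᵢ] = κ·Ξᵢ`, `κ = ∫_{𝓕_I ∩ {‖x‖ ≤ 1}} ‖x‖ dν_I` (Mathlib `integral_mul_const`).  SURVIVOR: `hdec′` ONLY (the decay of `E(f′) − E(f′)_B` on `{H > T}`, the [D2] chain).  This is the `hrel`∕`hRz`
feed of the pole-control capstone at the spherical vector. [cite: MoeglinWaldspurger1995, II.1.6–II.1.7 and IV.2.3] [cite: Arthur1980TraceFormulaII, §4] [cite: Garrett2018, §11.3] -/
theorem maassSelberg_flatSectionU_cm_three_final_const
    (μ : Measure (quasiSplit (↥(maximalRealSubfield L)) L (IsCMField.complexConj L) 3).automorphicQuotient) [(quasiSplit (↥(maximalRealSubfield L)) L (IsCMField.complexConj L) 3).IsAutomorphicMeasure μ]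
    (νG : Measure (quasiSplit (↥(maximalRealSubfield L)) L (IsCMField.complexConj L) 3).Adelic) [νG.IsHaarMeasure] [νG.IsInvInvariant]
    (μK : Measure ((standardMaximalCompactGL 3 L).comap (adelicVal (↥(maximalRealSubfield L)) L (IsCMField.complexConj L) 3 ((StdForm.antidiagonal 3).over L)) : Subgroup (quasiSplit (↥(maximalRealSubfield L)) L (IsCMField.complexConj L) 3).Adelic))
    [μK.IsHaarMeasure]
    (νI : Measure (AdeleRing (𝓞 L) L)ˣ) [νI.IsHaarMeasure]
    {𝓕I : Set (AdeleRing (𝓞 L) L)ˣ} (h𝓕I : IsIdeleClassDomain L 𝓕I)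
    (ν : Measure ↥(adelicUnipotent (↥(maximalRealSubfield L)) L (IsCMField.complexConj L) 3)) [ν.IsHaarMeasure] [ν.IsInvInvariant]
    {𝓕 : Set ↥(adelicUnipotent (↥(maximalRealSubfield L)) L (IsCMField.complexConj L) 3)} (h𝓕N : IsFundamentalDomain ↥(rationalUnipotent (↥(maximalRealSubfield L)) L (IsCMField.complexConj L) 3) 𝓕 ν) (h𝓕1 : ν 𝓕 = 1) (h𝓕c : IsCompact (closure 𝓕)) :
    ∃ cμ K : ℝ, 0 < cμ ∧ 0 < K ∧
      ∀ {β : (quasiSplit (↥(maximalRealSubfield L)) L (IsCMField.complexConj L) 3).Adelic → ℝ≥0∞}, IsCoveringWeight ((arithmeticBorel (↥(maximalRealSubfield L)) L (IsCMField.complexConj L) 3).map (quasiSplit (↥(maximalRealSubfield L)) L (IsCMField.complexConj L) 3).arithmeticSubgroup.subtype) β →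
      ∀ {T : ℝ≥0}, 1 ≤ T →
      ∀ (φ₀ φ₀' : ℂ),
      ∀ {z z' : ℂ}, 2 < z'.re → z'.re < z.re →
      -- NAMED: the decay `hdec′` of `E(f′_{z′}) − E(f′_{z′})_B` on the Siegel region `{H > T}` ([D2] chain ⟹ `hΛbdd` via ★ p857707) — NOTHING ELSE (the `K_U`-averages are the constants of §3, the brackets explicit)
        ∀ {M₁ : ℝ}, (∀ g : (quasiSplit (↥(maximalRealSubfield L)) L (IsCMField.complexConj L) 3).Adelic, T < borelHeight g →
          ‖eisensteinSeriesU (flatSectionU (fun _ : (quasiSplit (↥(maximalRealSubfield L)) L (IsCMField.complexConj L) 3).Adelic => φ₀') z') g - borelConstantTerm ν 𝓕 (eisensteinSeriesU (flatSectionU (fun _ : (quasiSplit (↥(maximalRealSubfield L)) L (IsCMField.complexConj L) 3).Adelic => φ₀') z')) g‖ ≤ M₁) →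
        ∫ x, (quasiSplit (↥(maximalRealSubfield L)) L (IsCMField.complexConj L) 3).quotFun (truncation ν 𝓕 T (eisensteinSeriesU (flatSectionU (fun _ : (quasiSplit (↥(maximalRealSubfield L)) L (IsCMField.complexConj L) 3).Adelic => φ₀) z))) x * conj ((quasiSplit (↥(maximalRealSubfield L)) L (IsCMField.complexConj L) 3).quotFun (truncation ν 𝓕 T (eisensteinSeriesU (flatSectionU (fun _ : (quasiSplit (↥(maximalRealSubfield L)) L (IsCMField.complexConj L) 3).Adelic => φ₀') z'))) x) ∂μ =
          (cμ : ℂ) * ((K : ℂ) *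
            ((((T : ℝ) : ℂ) ^ (z + conj z' - 2) / (z + conj z' - 2)) * ((∫ x in {x : (AdeleRing (𝓞 L) L)ˣ | (IdeleClassGroup.ideleNorm L x : ℝ) ≤ 1} ∩ 𝓕I, ((IdeleClassGroup.ideleNorm L x : ℝ) : ℂ) ∂νI) * (((μK.real Set.univ : ℝ) : ℂ) * (φ₀ * conj φ₀')))
              + (((T : ℝ) : ℂ) ^ (z - conj z') / (z - conj z')) * ((∫ x in {x : (AdeleRing (𝓞 L) L)ˣ | (IdeleClassGroup.ideleNorm L x : ℝ) ≤ 1} ∩ 𝓕I, ((IdeleClassGroup.ideleNorm L x : ℝ) : ℂ) ∂νI) * (((μK.real Set.univ : ℝ) : ℂ) * (φ₀ * conj ((∫ v : ↥(adelicUnipotent (↥(maximalRealSubfield L)) L (IsCMField.complexConj L) 3), (((borelHeight ((quasiSplit (↥(maximalRealSubfield L)) L (IsCMField.complexConj L) 3).toAdelic (weylLongU ((IsCMField.complexConj L : L ≃ₐ[↥(maximalRealSubfield L)] L) : L →+* L) (rfl : (StdForm.antidiagonal 3).over L = (StdForm.antidiagonal 3).over L)) * (v : (quasiSplit (↥(maximalRealSubfield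 L)) L (IsCMField.complexConj L) 3).Adelic))) : ℝ) : ℂ) ^ z' ∂ν) * φ₀'))))
              - (((T : ℝ) : ℂ) ^ (-(z - conj z')) / (z - conj z')) * ((∫ x in {x : (AdeleRing (𝓞 L) L)ˣ | (IdeleClassGroup.ideleNorm L x : ℝ) ≤ 1} ∩ 𝓕I, ((IdeleClassGroup.ideleNorm L x : ℝ) : ℂ) ∂νI) * (((μK.real Set.univ : ℝ) : ℂ) * ((∫ v : ↥(adelicUnipotent (↥(maximalRealSubfield L)) L (IsCMField.complexConj L) 3), (((borelHeight ((quasiSplit (↥(maximalRealSubfield L)) L (IsCMField.complexConj L) 3).toAdelic (weylLongU ((IsCMField.complexConj L : L ≃ₐ[↥(maximalRealSubfield L)] L) : L →+* L) (rfl : (StdForm.antidiagonal 3).over L = (StdForm.antidiagonal 3).over L)) * (v : (quasiSplit (↥(maximalRealSubfield L)) L (IsCMField.complexConj L) 3).Adelic))) : ℝ) : ℂ) ^ z ∂ν) * φ₀ * conj φ₀')))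
              - (((T : ℝ) : ℂ) ^ (-(z + conj z' - 2)) / (z + conj z' - 2)) * ((∫ x in {x : (AdeleRing (𝓞 L) L)ˣ | (IdeleClassGroup.ideleNorm L x : ℝ) ≤ 1} ∩ 𝓕I, ((IdeleClassGroup.ideleNorm L x : ℝ) : ℂ) ∂νI) * (((μK.real Set.univ : ℝ) : ℂ) * ((∫ v : ↥(adelicUnipotent (↥(maximalRealSubfield L)) L (IsCMField.complexConj L) 3), (((borelHeight ((quasiSplit (↥(maximalRealSubfield L)) L (IsCMField.complexConj L) 3).toAdelic (weylLongU ((IsCMField.complexConj L : L ≃ₐ[↥(maximalRealSubfield L)] L) : L →+* L) (rfl : (StdForm.antidiagonal 3).over L = (StdForm.antidiagonal 3).over L)) * (v : (quasiSplit (↥(maximalRealSubfield L)) L (IsCMField.complexConj L) 3).Adelic))) : ℝ) : ℂ) ^ z ∂ν) * φ₀ * conj ((∫ v : ↥(adelicUnipotent (↥(maximalRealSubfield L)) L (IsCMField.complexConj L) 3), (((borelHeight ((quasiSplit (↥(maximalRealSubfield L)) L (IsCMField.complexConj L) 3).toAdelic (weylLongU ((IsCMField.complexConj L : L ≃ₐ[↥(maximalRealSubfield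 L)] L) : L →+* L) (rfl : (StdForm.antidiagonal 3).over L = (StdForm.antidiagonal 3).over L)) * (v : (quasiSplit (↥(maximalRealSubfield L)) L (IsCMField.complexConj L) 3).Adelic))) : ℝ) : ℂ) ^ z' ∂ν) * φ₀')))))) := by
  obtain ⟨cμ, K, hcμ, hK, h⟩ := maassSelberg_flatSectionU_cm_three_final' L μ νG μK νI h𝓕I ν h𝓕N h𝓕1 h𝓕c
  refine ⟨cμ, K, hcμ, hK, ?_⟩
  intro β hβ T hT φ₀ φ₀' z z' hz' hzz' M₁ hdec'
  have hc : IsCMField.complexConj L * IsCMField.complexConj L = 1 := AlgEquiv.ext fun x => IsCMField.complexConj_apply_apply L x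
  have hc1 : IsCMField.complexConj L ≠ 1 := IsCMField.complexConj_ne_one L
  have hBK := exists_mem_borelAdelic_mul_mem_standardMaximalCompactGL_cm_three L
  have key := h hβ hT (φ := fun _ : (quasiSplit (↥(maximalRealSubfield L)) L (IsCMField.complexConj L) 3).Adelic => φ₀) (φ' := fun _ : (quasiSplit (↥(maximalRealSubfield L)) L (IsCMField.complexConj L) 3).Adelic => φ₀') continuous_const (fun _ _ => rfl) (fun _ _ _ => rfl) (Cφ := ‖φ₀‖) (fun _ => le_rfl)
    continuous_const (fun _ _ => rfl) (fun _ _ _ => rfl) (Cφ' := ‖φ₀'‖) (fun _ => le_rfl) hz' hzz' hdec'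
    (Ξ₁ := fun _ : (AdeleRing (𝓞 L) L)ˣ => (((μK.real Set.univ : ℝ) : ℂ) * (φ₀ * conj φ₀'))) (Ξ₂ := fun _ : (AdeleRing (𝓞 L) L)ˣ => (((μK.real Set.univ : ℝ) : ℂ) * (φ₀ * conj ((∫ v : ↥(adelicUnipotent (↥(maximalRealSubfield L)) L (IsCMField.complexConj L) 3), (((borelHeight ((quasiSplit (↥(maximalRealSubfield L)) L (IsCMField.complexConj L) 3).toAdelic (weylLongU ((IsCMField.complexConj L : L ≃ₐ[↥(maximalRealSubfield L)] L) : L →+* L) (rfl : (StdForm.antidiagonal 3).over L = (StdForm.antidiagonal 3).over L)) * (v : (quasiSplit (↥(maximalRealSubfield L)) L (IsCMField.complexConj L) 3).Adelic))) : ℝ) : ℂ) ^ z' ∂ν) * φ₀'))))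
    (Ξ₃ := fun _ : (AdeleRing (𝓞 L) L)ˣ => (((μK.real Set.univ : ℝ) : ℂ) * ((∫ v : ↥(adelicUnipotent (↥(maximalRealSubfield L)) L (IsCMField.complexConj L) 3), (((borelHeight ((quasiSplit (↥(maximalRealSubfield L)) L (IsCMField.complexConj L) 3).toAdelic (weylLongU ((IsCMField.complexConj L : L ≃ₐ[↥(maximalRealSubfield L)] L) : L →+* L) (rfl : (StdForm.antidiagonal 3).over L = (StdForm.antidiagonal 3).over L)) * (v : (quasiSplit (↥(maximalRealSubfield L)) L (IsCMField.complexConj L) 3).Adelic))) : ℝ) : ℂ) ^ z ∂ν) * φ₀ * conj φ₀'))) (Ξ₄ := fun _ : (AdeleRing (𝓞 L) L)ˣ => (((μK.real Set.univ : ℝ) : ℂ) * ((∫ v : ↥(adelicUnipotent (↥(maximalRealSubfield L)) L (IsCMField.complexConj L) 3), (((borelHeight ((quasiSplit (↥(maximalRealSubfield L)) L (IsCMField.complexConj L) 3).toAdelic (weylLongU ((IsCMField.complexConj L : L ≃ₐ[↥(maximalRealSubfield L)] L) : L →+* L) (rfl : (StdForm.antidiagonal 3).over L = (StdForm.antidiagonal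 3).over L)) * (v : (quasiSplit (↥(maximalRealSubfield L)) L (IsCMField.complexConj L) 3).Adelic))) : ℝ) : ℂ) ^ z ∂ν) * φ₀ * conj ((∫ v : ↥(adelicUnipotent (↥(maximalRealSubfield L)) L (IsCMField.complexConj L) 3), (((borelHeight ((quasiSplit (↥(maximalRealSubfield L)) L (IsCMField.complexConj L) 3).toAdelic (weylLongU ((IsCMField.complexConj L : L ≃ₐ[↥(maximalRealSubfield L)] L) : L →+* L) (rfl : (StdForm.antidiagonal 3).over L = (StdForm.antidiagonal 3).over L)) * (v : (quasiSplit (↥(maximalRealSubfield L)) L (IsCMField.complexConj L) 3).Adelic))) : ℝ) : ℂ) ^ z' ∂ν) * φ₀'))))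
    measurable_const (CΞ₁ := ‖(((μK.real Set.univ : ℝ) : ℂ) * (φ₀ * conj φ₀'))‖) (fun _ => le_rfl) (fun _ _ _ => rfl) (fun _ _ => rfl) (average_const_mul_conj_const μK φ₀ φ₀')
    measurable_const (CΞ₂ := ‖(((μK.real Set.univ : ℝ) : ℂ) * (φ₀ * conj ((∫ v : ↥(adelicUnipotent (↥(maximalRealSubfield L)) L (IsCMField.complexConj L) 3), (((borelHeight ((quasiSplit (↥(maximalRealSubfield L)) L (IsCMField.complexConj L) 3).toAdelic (weylLongU ((IsCMField.complexConj L : L ≃ₐ[↥(maximalRealSubfield L)] L) : L →+* L) (rfl : (StdForm.antidiagonal 3).over L = (StdForm.antidiagonal 3).over L)) * (v : (quasiSplit (↥(maximalRealSubfield L)) L (IsCMField.complexConj L) 3).Adelic))) : ℝ) : ℂ) ^ z' ∂ν) * φ₀')))‖) (fun _ => le_rfl) (fun _ _ _ => rfl) (fun _ _ => rfl) (average_const_mul_conj_intertwinedCoeff_const hc hc1 ν hBK μK φ₀ φ₀' z')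
    measurable_const (CΞ₃ := ‖(((μK.real Set.univ : ℝ) : ℂ) * ((∫ v : ↥(adelicUnipotent (↥(maximalRealSubfield L)) L (IsCMField.complexConj L) 3), (((borelHeight ((quasiSplit (↥(maximalRealSubfield L)) L (IsCMField.complexConj L) 3).toAdelic (weylLongU ((IsCMField.complexConj L : L ≃ₐ[↥(maximalRealSubfield L)] L) : L →+* L) (rfl : (StdForm.antidiagonal 3).over L = (StdForm.antidiagonal 3).over L)) * (v : (quasiSplit (↥(maximalRealSubfield L)) L (IsCMField.complexConj L) 3).Adelic))) : ℝ) : ℂ) ^ z ∂ν) * φ₀ * conj φ₀'))‖) (fun _ => le_rfl) (fun _ _ _ => rfl) (fun _ _ => rfl) (average_intertwinedCoeff_const_mul_conj_const hc hc1 ν hBK μK φ₀ φ₀' z)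
    measurable_const (CΞ₄ := ‖(((μK.real Set.univ : ℝ) : ℂ) * ((∫ v : ↥(adelicUnipotent (↥(maximalRealSubfield L)) L (IsCMField.complexConj L) 3), (((borelHeight ((quasiSplit (↥(maximalRealSubfield L)) L (IsCMField.complexConj L) 3).toAdelic (weylLongU ((IsCMField.complexConj L : L ≃ₐ[↥(maximalRealSubfield L)] L) : L →+* L) (rfl : (StdForm.antidiagonal 3).over L = (StdForm.antidiagonal 3).over L)) * (v : (quasiSplit (↥(maximalRealSubfield L)) L (IsCMField.complexConj L) 3).Adelic))) : ℝ) : ℂ) ^ z ∂ν) * φ₀ * conj ((∫ v : ↥(adelicUnipotent (↥(maximalRealSubfield L)) L (IsCMField.complexConj L) 3), (((borelHeight ((quasiSplit (↥(maximalRealSubfield L)) L (IsCMField.complexConj L) 3).toAdelic (weylLongU ((IsCMField.complexConj L : L ≃ₐ[↥(maximalRealSubfield L)] L) : L →+* L) (rfl : (StdForm.antidiagonal 3).over L = (StdForm.antidiagonal 3).over L)) * (v : (quasiSplit (↥(maximalRealSubfield L)) L (IsCMField.complexConj L) 3).Adelic))) : ℝ) : ℂ) ^ z' ∂ν) * φ₀')))‖)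 (fun _ => le_rfl) (fun _ _ _ => rfl) (fun _ _ => rfl) (average_intertwinedCoeff_const_mul_conj_intertwinedCoeff_const hc hc1 ν hBK μK φ₀ φ₀' z z')
  simpa only [integral_mul_const] using key

end CM


/-! ## §5 (ED. 2) The two scalars of the spherical brackets are positive reals: `κ = ↑κ_ℝ` (and `0 < κ_ℝ`, §3b), `0 < m` (dealer K2E1-plan (g4) 07:03:01Z INCLUDE-list) -/

section Scalars

variable {F E : Type} [Field F] [NumberField F] [Field E] [NumberField E] [Algebra F E] {c : E ≃ₐ[F] E}

/-- **`κ = ↑κ_ℝ`**: the complex idele-class bracket of §4 is the real one of §3b, `∫_{𝓕_I ∩ {‖x‖≤1}} ↑‖x‖ dν_I = ↑(∫_{𝓕_I ∩ {‖x‖≤1}} ‖x‖ dν_I)` (Mathlib `integral_ofReal`); with ★ `idelicBracket_pos`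
this is the `κ = ↑κ_ℝ ∧ 0 < κ_ℝ` datum of the spherical pole-control capstone. [folklore] -/
theorem idelicBracket_eq_ofReal [MeasurableSpace (AdeleRing (𝓞 E) E)ˣ] (νI : Measure (AdeleRing (𝓞 E) E)ˣ) (𝓕I : Set (AdeleRing (𝓞 E) E)ˣ) :
    (∫ x in {x : (AdeleRing (𝓞 E) E)ˣ | (IdeleClassGroup.ideleNorm E x : ℝ) ≤ 1} ∩ 𝓕I, ((IdeleClassGroup.ideleNorm E x : ℝ) : ℂ) ∂νI) =
      ((∫ x in {x : (AdeleRing (𝓞 E) E)ˣ | (IdeleClassGroup.ideleNorm E x : ℝ) ≤ 1} ∩ 𝓕I, (IdeleClassGroup.ideleNorm E x : ℝ) ∂νI : ℝ) : ℂ) :=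
  integral_ofReal

/-- **`0 < m = μ_K(K_U)`**: a Haar measure is positive on the (open, nonempty) whole group and `K_U` is compact (★ `isCompact_comap_adelicVal_standardMaximalCompactGL`), so `m = μ_K(K_U) ∈ (0, ∞)`
— the last factor of the capstone's `a = κ_ℝ·m·|φ₀|² > 0`. [folklore] -/
theorem measureReal_maximalCompact_pos [MeasurableSpace (quasiSplit F E c 3).Adelic] [BorelSpace (quasiSplit F E c 3).Adelic] (μK : Measure ((standardMaximalCompactGL 3 E).comap (adelicVal F E c 3 ((StdForm.antidiagonal 3).over E)) : Subgroup (quasiSplit F E c 3).Adelic)) [μK.IsHaarMeasure] : 0 < μK.real Set.univ := by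
  have hKc : IsCompact ((((standardMaximalCompactGL 3 E).comap (adelicVal F E c 3 ((StdForm.antidiagonal 3).over E)) : Subgroup (quasiSplit F E c 3).Adelic)) : Set (quasiSplit F E c 3).Adelic) := isCompact_comap_adelicVal_standardMaximalCompactGL
  haveI : CompactSpace ((standardMaximalCompactGL 3 E).comap (adelicVal F E c 3 ((StdForm.antidiagonal 3).over E)) : Subgroup (quasiSplit F E c 3).Adelic) := isCompact_iff_compactSpace.1 hKc
  haveI : IsFiniteMeasure μK := CompactSpace.isFiniteMeasure
  rw [measureReal_def]
  exact ENNReal.toReal_pos (isOpen_univ.measure_pos μK univ_nonempty).ne' (measure_ne_top μK _)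

end Scalars

end Summit.HodgeConjecture.HodgeConjecture.Cruxes.H413.K2E1MaassSelbergSphericalBracketsCMThree

end
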